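import Summits.QuantumAdvantage.QuantumAdvantage.Theorems.WbwObfuscatedGluedTreesKowFPExtension
import Summits.QuantumAdvantage.QuantumAdvantage.Theorems.WbwObfuscatedGluedTreesKowSeedLaw
import Literature.Computability.Complexity.BPPErrorReduction
import Literature.Computability.Complexity.StringEquality
import Literature.Computability.Cryptography.IndistinguishabilityObfuscator
import Literature.Computability.Cryptography.IndistinguishabilityRepeated

/-!
# `WbwObfuscatedGluedTrees` (stmt-QuantumAdvantage-2340) — line `knowledge-of-walk-split`, stub `stub_bestPossibleStep` I: the distinguisher

Lead's stub (hardest) of the line: the best-possible step.  This file builds the iO DISTINGUISHER used in the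
keyed hybrid and identifies its acceptance probability.

Given a (prefix-stable) search adversary `A₁ : {0,1}* → {0,1}*` whose coin budget is bounded by the polynomial
`B` and unchanged in law under any larger budget (`CoinNormalisation.norm`), the distinguisher
`dist A₁ B : RandAlg (List Bool) Bool` reads its input `⟨a, ⟨1^κ, code⟩⟩` with advice `a = ⟨u, ⟨e, t⟩⟩`
(intended: `u = 1ⁿ`, `e = name of ENTRANCE`, `t = the answer`), runs `A₁` on the re-assembled instance
`x' = ⟨u, ⟨code, e⟩⟩` with its own coins and accepts iff `t` is a prefix of the output.  Results:
`isPPT_dist` (an `FP` brick program around `A₁`'s machine: `FPExtension.exists_FP_run`, `eqPairFn`, `takeFn`),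
`pr_dist_true` (`Pr[dist accepts ⟨a, ⟨1^κ, code⟩⟩] = A₁.pr x' {y | t <+: y}`, by prefix stability) and
`acceptPMFAdv_dist` (against the obfuscation law `O.obfCodePMF κ C` the acceptance probability is the uniform
average over the obfuscator's coins `r` of `A₁.pr ⟨u, ⟨code of O(κ, C; r), e⟩⟩ {y | t <+: y}`).
-/

set_option linter.dupNamespace false

noncomputable section

namespace Summit.QuantumAdvantage.QuantumAdvantage.Theorems.WbwObfuscatedGluedTrees.KnowledgeOfWalk

open Literature.Computability.Cryptography Literature.Computability.Complexity
open _root_.Computability Polynomial Brick Plumb Filter Asymptotics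

namespace BestPossibleStep

/-! ### Parsing the distinguisher's input `⟨⟨u, ⟨e, t⟩⟩, ⟨1^κ, code⟩⟩` -/

/-- The re-assembled instance `x' = ⟨u, ⟨code, e⟩⟩`. [folklore] -/
def xOf (inp : List Bool) : List Bool :=
  boolPair (fstF (fstF inp)) (boolPair (sndF (sndF inp)) (fstF (sndF (fstF inp))))

/-- The target prefix `t` carried by the advice. [folklore] -/
def tOf (inp : List Bool) : List Bool := sndF (sndF (fstF inp))

/-- `xOf` on a well-formed input. [folklore] -/
@[simp] theorem xOf_apply (u e t v code : List Bool) :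
    xOf (boolPair (boolPair u (boolPair e t)) (boolPair v code)) = boolPair u (boolPair code e) := by
  simp [xOf]

/-- `tOf` on a well-formed input. [folklore] -/
@[simp] theorem tOf_apply (u e t w : List Bool) : tOf (boolPair (boolPair u (boolPair e t)) w) = t := by
  simp [tOf]

/-- The re-assembled instance is at most `3 |inp| + 4` long. [folklore] -/
theorem length_xOf_le (inp : List Bool) : (xOf inp).length ≤ 3 * inp.length + 4 := by
  have h1 := length_fstF_sndF_le inp
  have h2 := length_fstF_sndF_le (fstF inp)
  have h3 := length_fstF_sndF_le (sndF inp)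
  have h4 := length_fstF_sndF_le (sndF (fstF inp))
  simp only [xOf, length_boolPair]
  omega

/-- `xOf` is a brick. [folklore] -/
theorem xOf_eq : xOf = fanoutFn (fstF ∘ fstF) (fanoutFn (sndF ∘ sndF) (fstF ∘ sndF ∘ fstF)) := by
  funext inp; simp [xOf]

/-- `xOf ∈ FP`. [folklore] -/
theorem xOf_mem_FP : xOf ∈ FP := by
  rw [xOf_eq]
  exact fanoutFn_mem_FP (comp_mem_FP fstF_mem_FP fstF_mem_FP)
    (fanoutFn_mem_FP (comp_mem_FP sndF_mem_FP sndF_mem_FP)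
      (comp_mem_FP fstF_mem_FP (comp_mem_FP sndF_mem_FP fstF_mem_FP)))

/-- `tOf ∈ FP`. [folklore] -/
theorem tOf_mem_FP : tOf ∈ FP :=
  comp_mem_FP sndF_mem_FP (comp_mem_FP sndF_mem_FP fstF_mem_FP)

/-! ### The instances -/

/-- The instance handed to the adversary at level `n`, key `k`, obfuscator coins `r`:
`⟨1ⁿ, ⟨code of O(κ n, C k; r), nm k⟩⟩` (`= ⟨1ⁿ, genObf … s⟩` for a seed `s` with key `k` and coin prefix `r`).
[folklore] -/
def xInst (O : CircuitObfuscator) (κ : ℕ → ℕ) (m : List Bool → ℕ) (C : (k : List Bool) → Circuit (Fin (m k)))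
    (nm : List Bool → List Bool) (n : ℕ) (k r : List Bool) : List Bool :=
  boolPair (unaryEncodeNat n) (boolPair (encodeSizedCircuit ⟨m k, O.obf (κ n) (C k) r⟩) (nm k))

/-! ### The distinguisher -/

/-- **The distinguisher of the best-possible step**: run `A₁` on `x' = ⟨u, ⟨code, e⟩⟩` with the own coins and
accept iff the advice's target `t` is a prefix of the output; coin budget `B(3L + 4) ≥ B(|x'|)`.
[cite: GargEtAl2013, Def. 1] -/
def dist (A₁ : RandAlg (List Bool) (List Bool)) (B : Polynomial ℕ) : RandAlg (List Bool) Bool where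
  run inp ρ := decide (tOf inp <+: A₁.run (xOf inp) ρ)
  coinLen L := B.eval (3 * L + 4)

variable {A₁ : RandAlg (List Bool) (List Bool)} {B : Polynomial ℕ}

/-- Prefix test as a `take`-equality. [folklore] -/
theorem decide_isPrefix_eq (t y : List Bool) : decide (t <+: y) = decide (y.take t.length = t) := by
  by_cases h : t <+: y
  · rw [decide_eq_true h, decide_eq_true ((List.prefix_iff_eq_take.1 h).symm)]
  · rw [decide_eq_false h, decide_eq_false (fun h' => h (List.prefix_iff_eq_take.2 h'.symm))]

/-- **The distinguisher is PPT** whenever `A₁` is. [folklore] -/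
theorem isPPT_dist (hA₁ : IsPPT A₁ id) (B : Polynomial ℕ) : IsPPT (dist A₁ B) encodeBool := by
  obtain ⟨R, hR, hRrun⟩ := FPExtension.exists_FP_run hA₁
  let T : List Bool → List Bool := tOf ∘ fstF
  let Y : List Bool → List Bool := R ∘ fanoutFn (xOf ∘ fstF) sndF
  let F : List Bool → List Bool := eqPairFn ∘ fanoutFn (takeFn ∘ fanoutFn T Y) T
  have hT : T ∈ FP := comp_mem_FP tOf_mem_FP fstF_mem_FP
  have hY : Y ∈ FP := comp_mem_FP hR (fanoutFn_mem_FP (comp_mem_FP xOf_mem_FP fstF_mem_FP) sndF_mem_FP)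
  have hF : F ∈ FP :=
    comp_mem_FP eqPairFn_mem_FP (fanoutFn_mem_FP (comp_mem_FP takeFn_mem_FP (fanoutFn_mem_FP hT hY)) hT)
  refine FPExtension.isPolyTime_of_FP (F := F) hF (fun inp ρ => ?_) ⟨B.comp (3 * X + 4), fun L => ?_⟩
  · have hY' : Y (boolPair inp ρ) = A₁.run (xOf inp) ρ := by
      simp only [Y, Function.comp_apply, fanoutFn_apply, fstF_boolPair, sndF_boolPair, hRrun]
    simp only [F, T, Function.comp_apply, fanoutFn_apply, fstF_boolPair, hY', takeFn_boolPair,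
      eqPairFn_boolPair, dist, decide_isPrefix_eq]
    rfl
  · simp [dist]

/-- **Acceptance probability of the distinguisher** on one input: if `A₁` is prefix-stable above its budget
and `A₁.coinLen ≤ B` with `B` monotone (a polynomial), then
`Pr[dist accepts inp] = A₁.pr (xOf inp) {y | tOf inp <+: y}`. [folklore] -/
theorem pr_dist_true
    (hstab : ∀ (x : List Bool) (E : Set (List Bool)) (N : ℕ), A₁.coinLen x.length ≤ N →
      uniformProb N {ρ | A₁.run x ρ ∈ E} = A₁.pr id x E)
    (hB : ∀ L, A₁.coinLen L ≤ B.eval L) (inp : List Bool) :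
    (dist A₁ B).pr id inp {b | b = true} = A₁.pr id (xOf inp) {y | tOf inp <+: y} := by
  rw [RandAlg.pr_eq_uniformProb, id]
  have hN : A₁.coinLen (xOf inp).length ≤ (dist A₁ B).coinLen inp.length :=
    (hB _).trans (SeedLaw.natPoly_eval_mono B (length_xOf_le inp))
  rw [← hstab (xOf inp) {y | tOf inp <+: y} _ hN]
  congr 1
  ext ρ
  simp [dist]

/-- The `toReal` of the acceptance mass at `true` is the event probability `pr {true}`. [folklore] -/
theorem outputPMF_true_toReal' (D : RandAlg (List Bool) Bool) (x : List Bool) :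
    (D.outputPMF id x true).toReal = D.pr id x {b | b = true} := by
  rw [outputPMF_true_toReal]
  rfl

/-- **Acceptance probability against an obfuscation law.**  For every obfuscator `O`, security parameter
`κ₀`, circuit `C` and advice string `a`:
`Pr[dist(a, 1^{κ₀}, O(κ₀, C)) = 1] = avg_{r ∈ {0,1}^{coins}} A₁.pr (xOf ⟨a, ⟨1^{κ₀}, code of O(κ₀,C;r)⟩⟩) {t <+: ·}`.
[cite: GargEtAl2013, Def. 1] -/
theorem acceptPMFAdv_dist (O : CircuitObfuscator)
    (hstab : ∀ (x : List Bool) (E : Set (List Bool)) (N : ℕ), A₁.coinLen x.length ≤ N →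
      uniformProb N {ρ | A₁.run x ρ ∈ E} = A₁.pr id x E)
    (hB : ∀ L, A₁.coinLen L ≤ B.eval L) (κ₀ : ℕ) {n : ℕ} (C : Circuit (Fin n)) (a : List Bool) :
    (acceptPMFAdv (dist A₁ B) (fun _ => a) κ₀ (O.obfCodePMF κ₀ C) true).toReal =
      uniformAvg (O.coins κ₀ C) fun r =>
        A₁.pr id (xOf (boolPair a (boolPair (unaryEncodeNat κ₀) (encodeSizedCircuit ⟨n, O.obf κ₀ C r⟩))))
          {y | tOf (boolPair a (boolPair (unaryEncodeNat κ₀) (encodeSizedCircuit ⟨n, O.obf κ₀ C r⟩))) <+: y} := by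
  unfold acceptPMFAdv CircuitObfuscator.obfCodePMF CircuitObfuscator.obfPMF
  rw [PMF.map_comp, PMF.bind_map, bind_uniformBits_apply_toReal]
  refine uniformAvg_congr fun r _ => ?_
  rw [Function.comp_apply, Function.comp_apply, outputPMF_true_toReal', pr_dist_true hstab hB]

/-- The same with the advice in the intended format `a = ⟨1ⁿ, ⟨nm k, ans k⟩⟩` at `κ₀ = κ n`: the instance
handed to `A₁` is `xInst O κ m C nm n k r` and the test is `ans k <+: output`. [cite: GargEtAl2013, Def. 1] -/
theorem acceptPMFAdv_dist_key (O : CircuitObfuscator)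
    (hstab : ∀ (x : List Bool) (E : Set (List Bool)) (N : ℕ), A₁.coinLen x.length ≤ N →
      uniformProb N {ρ | A₁.run x ρ ∈ E} = A₁.pr id x E)
    (hB : ∀ L, A₁.coinLen L ≤ B.eval L) (κ : ℕ → ℕ) (m : List Bool → ℕ)
    (C : (k : List Bool) → Circuit (Fin (m k))) (nm ans : List Bool → List Bool) (n : ℕ) (k : List Bool) :
    (acceptPMFAdv (dist A₁ B) (fun _ => boolPair (unaryEncodeNat n) (boolPair (nm k) (ans k))) (κ n)
        (O.obfCodePMF (κ n) (C k)) true).toReal =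
      uniformAvg (O.coins (κ n) (C k)) fun r => A₁.pr id (xInst O κ m C nm n k r) {y | ans k <+: y} := by
  rw [acceptPMFAdv_dist O hstab hB]
  simp only [xOf_apply, tOf_apply]
  rfl

/-- **The keyed gap is an iO advantage.**  For two key-indexed families `C₀, C₁` on the same inputs,
`|avg_r A₁.pr (xInst … C₀ … k r) {ans k <+: ·} − avg_r A₁.pr (xInst … C₁ … k r) {ans k <+: ·}|` is the advised
iO advantage of `dist A₁ B` with advice `⟨1ⁿ, ⟨nm k, ans k⟩⟩` at `κ n`. [cite: GargEtAl2013, Def. 1] -/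
theorem gap_eq_ioAdvantageAdv (O : CircuitObfuscator)
    (hstab : ∀ (x : List Bool) (E : Set (List Bool)) (N : ℕ), A₁.coinLen x.length ≤ N →
      uniformProb N {ρ | A₁.run x ρ ∈ E} = A₁.pr id x E)
    (hB : ∀ L, A₁.coinLen L ≤ B.eval L) (κ : ℕ → ℕ) (m : List Bool → ℕ)
    (C₀ C₁ : (k : List Bool) → Circuit (Fin (m k))) (nm ans : List Bool → List Bool) (n : ℕ) (k : List Bool) :
    |(uniformAvg (O.coins (κ n) (C₀ k)) fun r => A₁.pr id (xInst O κ m C₀ nm n k r) {y | ans k <+: y}) -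
      (uniformAvg (O.coins (κ n) (C₁ k)) fun r => A₁.pr id (xInst O κ m C₁ nm n k r) {y | ans k <+: y})| =
      O.ioAdvantageAdv (dist A₁ B) (fun _ => boolPair (unaryEncodeNat n) (boolPair (nm k) (ans k))) (κ n)
        (C₀ k) (C₁ k) := by
  rw [CircuitObfuscator.ioAdvantageAdv, acceptPMFAdv_dist_key O hstab hB, acceptPMFAdv_dist_key O hstab hB]

end BestPossibleStep

/-- Registered helper stub of crux stmt-QuantumAdvantage-2340 (closed form of `BestPossibleStep.isPPT_dist`): the iO distinguisher of the best-possible step is PPT. [folklore] -/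
theorem toolkit_bpsDistinguisher :
    ∀ (A₁ : RandAlg (List Bool) (List Bool)) (B : Polynomial ℕ), IsPPT A₁ id → IsPPT (BestPossibleStep.dist A₁ B) encodeBool :=
  fun _ B hA₁ => BestPossibleStep.isPPT_dist hA₁ B

end Summit.QuantumAdvantage.QuantumAdvantage.Theorems.WbwObfuscatedGluedTrees.KnowledgeOfWalk

end
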